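import Literature.NumberTheory.GaloisCohomology.ShaRestrictedLayerToSelmer
import Literature.NumberTheory.GaloisRepresentations.ContinuousH1ClosedSubgroupColimit
import Literature.NumberTheory.GaloisRepresentations.ConjugationDescent
import Literature.NumberTheory.GaloisCohomology.ArchimedeanInvariantMap
import HarnessLib

/-!
# The local conditions of `Ш¹_S` in the limit over the layers: naturality of the layer localisations, triviality of the
# inner conjugations, vanishing at the complex places, and the LOCAL VANISHING AT `Gal(K̄_v/K̃_{∞,w})` from the strict /
# unramified conditions over `K̄^H`

Topic `Literature/NumberTheory/GaloisCohomology` (namespace `Literature.NumberTheory.GaloisCohomology.ShaLayer`, sequel of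
`ShaRestrictedLayerToSelmer`).  THEOREMS ONLY (no definition, no named fact, no instance, no `sorry`).  Degree `1` throughout;
`X = M′^{N_S}` as a `G_S`-representation, layers `V̄ = V.map π`, local groups `Λ_V = φ_v⁻¹ V̄ ≤ Γ_{K_v}` (`φ_v = π ∘ res_v`).

* §1 `layerLocalization_inr_resLe`, `layerConj_resLe`, `layerConj_mul`, `layerConj_eq_self_of_mem` — the layer localisation
  commutes with the restriction of layers; conjugation commutes with restriction, is multiplicative, and inner conjugations act
  trivially (the set `{conj_σ z}` is indexed by `G_S ⧸ V̄`);
* §2 `layerLocalization_inl_eq_zero` — at a complex place every layer localisation vanishes (`Γ_ℂ = 1`);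
* §3 `resLe_layerLocalization_layerConj_eq_zero` — THE LOCAL VANISHING IN THE LIMIT: if the conjugated cocycle
  `x ↦ τ·c(π(τ⁻¹ x τ))` is a coboundary `x ↦ x a′ − a′` on `H ⊓ D_v` (`H ≤ V` the group of `K̃_∞`, `a′ ∈ M′^{N_S}`), the localisation
  at `v` of `conj_{πτ} [c]` restricts to ZERO on `Λ_H = res_v⁻¹ H ≤ Λ_V`;
* §4 `two_nsmul_resLe_layerLocalization_layerConj_eq_zero` — the RAMIFIED variant: a coboundary on `H ⊓ I_v` only, but some element
  of `I_v ∩ H` acting as `−1` on `M′`, gives `2 •` the restricted localisation `= 0`.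

Written for cell `bsd-print-cf2` (seat cf2c-w8 g8, plug (π3) of ROW 1, local step).  HONEST FRAMING: Galois-cohomological bookkeeping.

## References
* J. S. Milne, *Arithmetic Duality Theorems* (2006), I §4 (p. 56). [MilneADT2006]
* J.-P. Serre, *Local Fields* (1979), VII §5 Prop. 3; *Galois Cohomology* (1997), I §2.2 Prop. 8, II §6.3. [SerreLocalFields1979] [SerreGaloisCohomology1997]
* J. Neukirch, A. Schmidt, K. Wingberg (2008), I §5 (1.5.6)–(1.5.7). [NeukirchSchmidtWingberg2008]
-/

noncomputable section

open Function Field IsDedekindDomain CategoryTheory NumberField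
open scoped NumberField Pointwise
open Literature.NumberTheory.GaloisRepresentations
open Literature.NumberTheory.GaloisRepresentations.DiscreteGaloisModule
open Literature.NumberTheory.EllipticCurves
open Literature.NumberTheory.EllipticCurves.GreenbergSelmer

namespace Literature.NumberTheory.GaloisCohomology.ShaLayer

variable {K : Type} [Field K] [NumberField K] (S : Set (HeightOneSpectrum (𝓞 K)))
variable {M' : Type} [AddCommGroup M'] [TopologicalSpace M'] [DiscreteTopology M'] (ρ : DiscreteGaloisModule K M')
variable {V V' : Subgroup (absoluteGaloisGroup K)}

/-! ## §1 Naturality of the layer localisation; conjugations -/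

/-- **Localisation commutes with restriction of layers** (finite place): for `V′ ≤ V`,
`loc_v (res^{V̄}_{V̄′} z) = res^{Λ_V}_{Λ_{V′}} (loc_v z)`. [cite: MilneADT2006, I §4 (p. 56)] [cite: NeukirchSchmidtWingberg2008, I §5 (1.5.6)] -/
theorem layerLocalization_inr_resLe (h : V' ≤ V) (v : HeightOneSpectrum (𝓞 K))
    (z : continuousCohomology 1 (subgroupRep (ρ.quotientInvariants (ramificationSubgroup K S)).toTopRep
        (V.map (toUnramifiedQuot K S)))) :
    layerLocalization S ρ V' (Sum.inr v) 1 ((resLe (ρ.quotientInvariants (ramificationSubgroup K S)).toTopRep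
        (Subgroup.map_mono h : V'.map (toUnramifiedQuot K S) ≤ V.map (toUnramifiedQuot K S)) 1).hom z) =
      (resLe (TopRep.res (locHom (S := S) v : absoluteGaloisGroup (v.adicCompletion K) →* GaloisGroupUnramifiedOutside K S)
          (ρ.quotientInvariants (ramificationSubgroup K S)).toTopRep)
        (Subgroup.comap_mono (Subgroup.map_mono h) :
          (V'.map (toUnramifiedQuot K S)).comap (locHom (S := S) v : absoluteGaloisGroup (v.adicCompletion K) →*
              GaloisGroupUnramifiedOutside K S) ≤
            (V.map (toUnramifiedQuot K S)).comap (locHom (S := S) v : _ →* _)) 1).hom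
        (layerLocalization S ρ V (Sum.inr v) 1 z) := by
  obtain ⟨c, rfl⟩ := oneCocycleClass_surjective _ z
  rw [layerLocalization_inr_eq, layerLocalization_inr_eq]
  change ContinuousCohomology.map _ _ 1 (resLe _ _ 1 (oneCocycleClass _ c)) =
    resLe _ _ 1 (ContinuousCohomology.map _ _ 1 (oneCocycleClass _ c))
  rw [resLe_oneCocycleClass, map_oneCocycleClass, map_oneCocycleClass, resLe_oneCocycleClass]
  exact congrArg _ (Subtype.ext (ContinuousMap.ext fun _ => rfl))

omit [NumberField K] in
/-- **Conjugation commutes with restriction of layers**: `conj_σ (res z) = res (conj_σ z)` (`V`, `V′` normal).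
[cite: SerreLocalFields1979, VII §5 Prop. 3] -/
theorem layerConj_resLe [V.Normal] [V'.Normal] (h : V' ≤ V) (σ : GaloisGroupUnramifiedOutside K S)
    (z : continuousCohomology 1 (subgroupRep (ρ.quotientInvariants (ramificationSubgroup K S)).toTopRep
        (V.map (toUnramifiedQuot K S)))) :
    layerConj S ρ V' σ 1 ((resLe (ρ.quotientInvariants (ramificationSubgroup K S)).toTopRep
        (Subgroup.map_mono h : V'.map (toUnramifiedQuot K S) ≤ V.map (toUnramifiedQuot K S)) 1).hom z) =
      (resLe (ρ.quotientInvariants (ramificationSubgroup K S)).toTopRep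
        (Subgroup.map_mono h : V'.map (toUnramifiedQuot K S) ≤ V.map (toUnramifiedQuot K S)) 1).hom (layerConj S ρ V σ 1 z) := by
  obtain ⟨c, rfl⟩ := oneCocycleClass_surjective _ z
  rw [layerConj_apply, layerConj_apply]
  change conjMap _ _ σ 1 (resLe _ _ 1 (oneCocycleClass _ c)) = resLe _ _ 1 (conjMap _ _ σ 1 (oneCocycleClass _ c))
  rw [resLe_oneCocycleClass, conjMap_oneCocycleClass, conjMap_oneCocycleClass, resLe_oneCocycleClass]
  exact congrArg _ (Subtype.ext (ContinuousMap.ext fun _ => rfl))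

omit [NumberField K] in
/-- **Multiplicativity**: `conj_{στ} = conj_σ ∘ conj_τ` on `H¹(V̄, ·)`. [cite: SerreLocalFields1979, VII §5 Prop. 3] -/
theorem layerConj_mul [V.Normal] (σ τ : GaloisGroupUnramifiedOutside K S)
    (z : continuousCohomology 1 (subgroupRep (ρ.quotientInvariants (ramificationSubgroup K S)).toTopRep
        (V.map (toUnramifiedQuot K S)))) :
    layerConj S ρ V (σ * τ) 1 z = layerConj S ρ V σ 1 (layerConj S ρ V τ 1 z) := by
  obtain ⟨c, rfl⟩ := oneCocycleClass_surjective _ z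
  rw [layerConj_apply, layerConj_apply, layerConj_apply]
  change conjMap _ _ _ 1 (oneCocycleClass _ c) = conjMap _ _ σ 1 (conjMap _ _ τ 1 (oneCocycleClass _ c))
  rw [conjMap_oneCocycleClass, conjMap_oneCocycleClass, conjMap_oneCocycleClass]
  refine congrArg _ (Subtype.ext (ContinuousMap.ext fun x => ?_))
  rw [conj_pullback_apply, conj_pullback_apply, conj_pullback_apply]
  have hx : subgroupConj (V.map (toUnramifiedQuot K S)) (σ * τ) x =
      subgroupConj (V.map (toUnramifiedQuot K S)) τ (subgroupConj (V.map (toUnramifiedQuot K S)) σ x) :=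
    Subtype.ext (by simp only [subgroupConj_apply_coe, mul_inv_rev, mul_assoc])
  rw [hx, map_mul]
  rfl

omit [NumberField K] in
/-- **Inner conjugations act trivially**: for `σ ∈ V̄`, `conj_σ z = z` on `H¹(V̄, ·)`. [cite: SerreLocalFields1979, VII §5 Prop. 3] -/
theorem layerConj_eq_self_of_mem [V.Normal] {σ : GaloisGroupUnramifiedOutside K S} (hσ : σ ∈ V.map (toUnramifiedQuot K S))
    (z : continuousCohomology 1 (subgroupRep (ρ.quotientInvariants (ramificationSubgroup K S)).toTopRep
        (V.map (toUnramifiedQuot K S)))) :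
    layerConj S ρ V σ 1 z = z := by
  rw [layerConj_apply]
  exact conjMap_eq_self_of_mem_one _ _ hσ z

/-! ## §2 Complex places -/

omit [NumberField K] in
/-- **At a complex place every layer localisation vanishes** (`Γ_{K_w} = 1`, so every cocycle of a subgroup of it is zero).
[cite: SerreGaloisCohomology1997, II §6.3] [cite: MilneADT2006, I Thm. 4.10 (a) (archimedean factors)] -/
theorem layerLocalization_inl_eq_zero [NumberField K] {w : InfinitePlace K} (hw : w.IsComplex)
    (z : continuousCohomology 1 (subgroupRep (ρ.quotientInvariants (ramificationSubgroup K S)).toTopRep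
        (V.map (toUnramifiedQuot K S)))) :
    layerLocalization S ρ V (Sum.inl w) 1 z = 0 := by
  obtain ⟨c, rfl⟩ := oneCocycleClass_surjective _ z
  change ContinuousCohomology.map _ _ 1 (oneCocycleClass _ c) = 0
  rw [map_oneCocycleClass, oneCocycleClass_eq_zero_iff]
  refine ⟨0, fun g => ?_⟩
  have hg : g = 1 := Subtype.ext (eq_one_absoluteGaloisGroup_of_isComplex hw _)
  rw [hg, contOneCocycles.apply_one, map_zero, sub_zero]

/-! ## §3 The local vanishing in the limit from a coboundary on `H ⊓ D_v` -/

variable {H : Subgroup (absoluteGaloisGroup K)}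

/-- `Λ_H = res_v⁻¹ H ≤ Λ_V = φ_v⁻¹ V̄` for `H ≤ V`. [cite: MilneADT2006, I §4 (p. 56)] -/
theorem comap_absGaloisRestrict_le_comap_locHom (hHV : H ≤ V) (v : HeightOneSpectrum (𝓞 K)) :
    H.comap (absGaloisRestrict K (v.adicCompletion K)).toMonoidHom ≤
      (V.map (toUnramifiedQuot K S)).comap
        (locHom (S := S) v : absoluteGaloisGroup (v.adicCompletion K) →* GaloisGroupUnramifiedOutside K S) :=
  fun _ hg => Subgroup.mem_comap.mpr (Subgroup.mem_map_of_mem (toUnramifiedQuot K S) (hHV (Subgroup.mem_comap.mp hg)))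

/-- **LOCAL VANISHING IN THE LIMIT (strict case).**  Let `H ≤ V ≤ Γ_K` (`V` normal), `v` a finite place, `τ ∈ Γ_K`, `c` a
cocycle of the layer `V̄` and `a ∈ M′^{N_S}` such that the conjugated cocycle is the coboundary of `a` on `H ⊓ D_v`:
`τ · c(π(τ⁻¹ x τ)) = x a − a` for `x ∈ H ⊓ D_v`.  Then the localisation at `v` of `conj_{πτ} [c]` restricts to ZERO on
`Λ_H = res_v⁻¹ H` — the class dies over `K̃_{∞,w}` for `H = Gal(K̄/K̃_∞)`. [cite: MilneADT2006, I §4 (p. 56)] [cite: SerreGaloisCohomology1997, I §2.2 Prop. 8] -/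
theorem resLe_layerLocalization_layerConj_eq_zero [V.Normal] (hHV : H ≤ V) (v : HeightOneSpectrum (𝓞 K))
    (τ : absoluteGaloisGroup K)
    (c : contOneCocycles (subgroupRep (ρ.quotientInvariants (ramificationSubgroup K S)).toTopRep
        (V.map (toUnramifiedQuot K S))))
    (a : Representation.invariants (ρ.toRepresentation.comp (ramificationSubgroup K S).subtype))
    (hc : ∀ (x : absoluteGaloisGroup K), x ∈ H → x ∈ decomp (K := K) v →
      ∀ hm : toUnramifiedQuot K S (τ⁻¹ * x * τ) ∈ V.map (toUnramifiedQuot K S),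
        (((ρ.quotientInvariants (ramificationSubgroup K S)).toTopRep.ρ (toUnramifiedQuot K S τ) (c.1 ⟨_, hm⟩) :
          Representation.invariants (ρ.toRepresentation.comp (ramificationSubgroup K S).subtype)) : M') =
          ρ x (a : M') - a) :
    (resLe (TopRep.res (locHom (S := S) v : absoluteGaloisGroup (v.adicCompletion K) →* GaloisGroupUnramifiedOutside K S)
          (ρ.quotientInvariants (ramificationSubgroup K S)).toTopRep)
        (comap_absGaloisRestrict_le_comap_locHom S hHV v) 1).hom
      (layerLocalization S ρ V (Sum.inr v) 1 (layerConj S ρ V (toUnramifiedQuot K S τ) 1 (oneCocycleClass _ c))) = 0 := by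
  rw [layerConj_apply, layerLocalization_inr_eq]
  change resLe _ _ 1 (ContinuousCohomology.map _ _ 1 (conjMap _ _ _ 1 (oneCocycleClass _ c))) = 0
  rw [conjMap_oneCocycleClass, map_oneCocycleClass, SubgroupRepColimit.resLe_oneCocycleClass_eq_zero_iff]
  refine ⟨a, fun g => ?_⟩
  have hxH : absGaloisRestrict K (v.adicCompletion K) (g : absoluteGaloisGroup (v.adicCompletion K)) ∈ H :=
    Subgroup.mem_comap.mp g.2
  have hxD : absGaloisRestrict K (v.adicCompletion K) (g : absoluteGaloisGroup (v.adicCompletion K)) ∈ decomp (K := K) v :=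
    ⟨g, rfl⟩
  have hm : toUnramifiedQuot K S (τ⁻¹ * absGaloisRestrict K (v.adicCompletion K) (g : absoluteGaloisGroup (v.adicCompletion K)) * τ) ∈
      V.map (toUnramifiedQuot K S) :=
    Subgroup.mem_map_of_mem _ ((inferInstance : V.Normal).conj_mem' _ (hHV hxH) τ)
  have hel : subgroupConj (V.map (toUnramifiedQuot K S)) (toUnramifiedQuot K S τ)
      (comapSubtypeHom (V.map (toUnramifiedQuot K S)) (locHom (S := S) v)
        (subgroupInclusion (comap_absGaloisRestrict_le_comap_locHom S hHV v) g)) = ⟨_, hm⟩ :=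
    Subtype.ext (by
      change ((toUnramifiedQuot K S) τ)⁻¹ * locHom (S := S) v (g : absoluteGaloisGroup (v.adicCompletion K)) *
          (toUnramifiedQuot K S) τ =
        toUnramifiedQuot K S (τ⁻¹ * absGaloisRestrict K (v.adicCompletion K) (g : absoluteGaloisGroup (v.adicCompletion K)) * τ)
      rw [map_mul, map_mul, map_inv]
      rfl)
  apply Subtype.ext
  rw [Submodule.coe_sub]
  change (((ρ.quotientInvariants (ramificationSubgroup K S)).toTopRep.ρ (toUnramifiedQuot K S τ)
      (c.1 (subgroupConj (V.map (toUnramifiedQuot K S)) (toUnramifiedQuot K S τ)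
        (comapSubtypeHom (V.map (toUnramifiedQuot K S)) (locHom (S := S) v)
          (subgroupInclusion (comap_absGaloisRestrict_le_comap_locHom S hHV v) g)))) :
      Representation.invariants (ρ.toRepresentation.comp (ramificationSubgroup K S).subtype)) : M') = _
  rw [hel]
  exact hc _ hxH hxD hm

/-! ## §4 The ramified variant: a coboundary on `H ⊓ I_v` only, `2 •` the class vanishes -/

/-- **Abstract `2`-torsion lemma.**  A continuous cocycle `φ` of `Λ` which is the coboundary of `a` on a normal subgroup `I`
containing an element `i₀` acting as `−1` satisfies `2[φ] = 0`: comparing `φ(i₀ g) = φ(g · g⁻¹i₀g)` gives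
`2 φ(g) = 2 (g a − a)`. [cite: SerreLocalFields1979, VII §5 Prop. 3] -/
theorem oneCocycleClass_add_self_eq_zero_of_neg {Λ : Type} [Group Λ] [TopologicalSpace Λ] [IsTopologicalGroup Λ]
    (X : TopRep ℤ Λ) (φ : contOneCocycles X) (a : X) (I : Subgroup Λ) [I.Normal]
    (h1 : ∀ i ∈ I, φ.1 i = X.ρ i a - a) {i₀ : Λ} (hi₀ : i₀ ∈ I) (hneg : ∀ m : X, X.ρ i₀ m = -m) :
    oneCocycleClass X φ + oneCocycleClass X φ = 0 := by
  rw [← oneCocycleClass_add, oneCocycleClass_eq_zero_iff]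
  refine ⟨a + a, fun g => ?_⟩
  change φ.1 g + φ.1 g = X.ρ g (a + a) - (a + a)
  have hj : g⁻¹ * i₀ * g ∈ I := (inferInstance : I.Normal).conj_mem' i₀ hi₀ g
  have hig : i₀ * g = g * (g⁻¹ * i₀ * g) := by group
  have hρj : X.ρ g (X.ρ (g⁻¹ * i₀ * g) a) = -(X.ρ g a) := by
    change (X.ρ g * X.ρ (g⁻¹ * i₀ * g)) a = _
    rw [← map_mul, show g * (g⁻¹ * i₀ * g) = i₀ * g by group, map_mul]
    change X.ρ i₀ (X.ρ g a) = _
    rw [hneg]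
  have h := φ.2 i₀ g
  rw [hig, φ.2 g (g⁻¹ * i₀ * g), h1 i₀ hi₀, h1 _ hj, map_sub, hρj, hneg, hneg] at h
  -- `h : φ g + (-(ρ g a) - ρ g a) = -a - a + -(φ g)`
  rw [map_add, ← sub_eq_zero]
  have h' := sub_eq_zero.mpr h
  have e : φ.1 g + φ.1 g - (X.ρ g a + X.ρ g a - (a + a)) =
      φ.1 g + (-(X.ρ g a) - X.ρ g a) - (-a - a + -(φ.1 g)) := by abel
  rw [e, h']

/-- **LOCAL `2`-TORSION IN THE LIMIT (unramified-but-ramified-coefficients case).**  As in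
`resLe_layerLocalization_layerConj_eq_zero`, but the conjugated cocycle is a coboundary of `a` only on `H ⊓ I_v` (the class is
UNRAMIFIED at `v`), and some `i₀ ∈ I_{K_v}` with `res i₀ ∈ H` acts as `−1` on `M′` (the coefficients are quadratically ramified
at `v`): then `2 •` the restriction to `Λ_H` of the localisation of `conj_{πτ} [c]` vanishes.
[cite: MilneADT2006, I §4 (p. 56)] [cite: SerreLocalFields1979, VII §5 Prop. 3] -/
theorem two_nsmul_resLe_layerLocalization_layerConj_eq_zero [V.Normal] (hHV : H ≤ V) (v : HeightOneSpectrum (𝓞 K))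
    (τ : absoluteGaloisGroup K)
    (c : contOneCocycles (subgroupRep (ρ.quotientInvariants (ramificationSubgroup K S)).toTopRep
        (V.map (toUnramifiedQuot K S))))
    (a : Representation.invariants (ρ.toRepresentation.comp (ramificationSubgroup K S).subtype))
    (hc : ∀ (x : absoluteGaloisGroup K), x ∈ H → x ∈ GreenbergSelmer.inertia (K := K) v →
      ∀ hm : toUnramifiedQuot K S (τ⁻¹ * x * τ) ∈ V.map (toUnramifiedQuot K S),
        (((ρ.quotientInvariants (ramificationSubgroup K S)).toTopRep.ρ (toUnramifiedQuot K S τ) (c.1 ⟨_, hm⟩) :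
          Representation.invariants (ρ.toRepresentation.comp (ramificationSubgroup K S).subtype)) : M') =
          ρ x (a : M') - a)
    (i₀ : absoluteGaloisGroup (v.adicCompletion K)) (hi₀ : i₀ ∈ absInertia (v.adicCompletion K))
    (hi₀H : absGaloisRestrict K (v.adicCompletion K) i₀ ∈ H)
    (hneg : ∀ m : M', ρ (absGaloisRestrict K (v.adicCompletion K) i₀) m = -m) :
    2 • (resLe (TopRep.res (locHom (S := S) v : absoluteGaloisGroup (v.adicCompletion K) →* GaloisGroupUnramifiedOutside K S)
          (ρ.quotientInvariants (ramificationSubgroup K S)).toTopRep)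
        (comap_absGaloisRestrict_le_comap_locHom S hHV v) 1).hom
      (layerLocalization S ρ V (Sum.inr v) 1 (layerConj S ρ V (toUnramifiedQuot K S τ) 1 (oneCocycleClass _ c))) = 0 := by
  haveI := absInertia_normal_holds (v.adicCompletion K)
  rw [layerConj_apply, layerLocalization_inr_eq]
  change 2 • resLe _ _ 1 (ContinuousCohomology.map _ _ 1 (conjMap _ _ _ 1 (oneCocycleClass _ c))) = 0
  rw [conjMap_oneCocycleClass, map_oneCocycleClass, resLe_oneCocycleClass, two_nsmul]
  refine oneCocycleClass_add_self_eq_zero_of_neg _ _ a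
    ((absInertia (v.adicCompletion K)).subgroupOf (H.comap (absGaloisRestrict K (v.adicCompletion K)).toMonoidHom))
    (fun i hi => ?_) (i₀ := ⟨i₀, Subgroup.mem_comap.mpr hi₀H⟩) (Subgroup.mem_subgroupOf.mpr hi₀) (fun m => ?_)
  · -- values on the inertial elements of `Λ_H`
    have hiI : (i : absoluteGaloisGroup (v.adicCompletion K)) ∈ absInertia (v.adicCompletion K) := Subgroup.mem_subgroupOf.mp hi
    have hxH : absGaloisRestrict K (v.adicCompletion K) (i : absoluteGaloisGroup (v.adicCompletion K)) ∈ H :=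
      Subgroup.mem_comap.mp i.2
    have hm : toUnramifiedQuot K S (τ⁻¹ * absGaloisRestrict K (v.adicCompletion K) (i : absoluteGaloisGroup (v.adicCompletion K)) * τ) ∈
        V.map (toUnramifiedQuot K S) :=
      Subgroup.mem_map_of_mem _ ((inferInstance : V.Normal).conj_mem' _ (hHV hxH) τ)
    have hel : subgroupConj (V.map (toUnramifiedQuot K S)) (toUnramifiedQuot K S τ)
        (comapSubtypeHom (V.map (toUnramifiedQuot K S)) (locHom (S := S) v)
          (subgroupInclusion (comap_absGaloisRestrict_le_comap_locHom S hHV v) i)) = ⟨_, hm⟩ :=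
      Subtype.ext (by
        change ((toUnramifiedQuot K S) τ)⁻¹ * locHom (S := S) v (i : absoluteGaloisGroup (v.adicCompletion K)) *
            (toUnramifiedQuot K S) τ =
          toUnramifiedQuot K S (τ⁻¹ * absGaloisRestrict K (v.adicCompletion K) (i : absoluteGaloisGroup (v.adicCompletion K)) * τ)
        rw [map_mul, map_mul, map_inv]
        rfl)
    apply Subtype.ext
    rw [Submodule.coe_sub]
    change (((ρ.quotientInvariants (ramificationSubgroup K S)).toTopRep.ρ (toUnramifiedQuot K S τ)
        (c.1 (subgroupConj (V.map (toUnramifiedQuot K S)) (toUnramifiedQuot K S τ)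
          (comapSubtypeHom (V.map (toUnramifiedQuot K S)) (locHom (S := S) v)
            (subgroupInclusion (comap_absGaloisRestrict_le_comap_locHom S hHV v) i)))) :
        Representation.invariants (ρ.toRepresentation.comp (ramificationSubgroup K S).subtype)) : M') = _
    rw [hel]
    exact hc _ hxH (Subgroup.mem_map_of_mem _ hiI) hm
  · -- `i₀` acts as `−1`
    apply Subtype.ext
    rw [Submodule.coe_neg]
    exact hneg (m : M')

end Literature.NumberTheory.GaloisCohomology.ShaLayer

end
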